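import Summits.QuantumFields.YangMills.Theorems.FluctuationComparisonRegPrIntLOrganTangentOneStepTransportUHOfSpreadFibreLawHJ
import Summits.QuantumFields.YangMills.Theorems.FluctuationComparisonRegPrIntLRunpairOrganDischargeInputsHJDefs
import Summits.QuantumFields.YangMills.Theorems.FluctuationComparisonRegPrIntLOrganTangentSpreadFibreLawHJOfDischargeInputs
import HarnessLib

/-!
# Crux `FluctuationComparisonRegPrIntL` (stmt-QuantumFields-20520, rung R3), PATH-B organ, v18.4 → v18.5 (H-currency): THE CONE'S APEX v2, THEOREMS-SIDE —
# **O1ᵘ-H v2.2 ⟸ `OrganDischargeInputsHJ`** by ONE composition: ✓p814811 (O1ᵘ-H v2.2 ⟸ `SpreadFibreLawHJ`) ∘ the DISCHARGE KNIT (`SpreadFibreLawHJ` ⟸ `OrganDischargeInputsHJ`)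

Cell `ym3-torus` (YM ladder rung R3 = continuum `SU(2)` Yang–Mills on the three-torus — a RUNG: NOT d = 4, NOT infinite volume, NOT a mass gap, NOT Clay).
Width seat `ym-ust-20520-w4` (gen 24), apex lineage (w4 g23 ✓p814811; CLAIM BY LINEAGE 2026-08-31 08:51Z); `--kind proof --supports stmt-QuantumFields-20520 --as helper`,
count-neutral, DEFINITION-FREE, no registry ∕ binder ∕ `Lines/` edit (registry `Lines/semiclassical_s2beta.lean`, ★★OWNER RULING №36, untouched; `Lines/runpair_organ.lean`
untouched — ideator g29's v18.5 «ROW-2 EDGE» cites this file by ONE name, as v18.4 §V18.G cites ✓p814811), default heartbeats, `autoImplicit false`.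

WHAT THIS IS.  ONE composition theorem and nothing else.  The registered stub `stub_oneStepTransportUH : OneStepTransportUH` of `Lines/runpair_organ.lean` (v18.2–v18.4)
states O1ᵘ-H v2.2; ✓p814811 `oneStepTransportUH_of_spreadFibreLawHJ` reduced it BY NAME to the frozen Jensen-superset hypothesis row `SpreadFibreLawHJ` (✓p814004, body ws16
3bd44078); LEAD-20520 w3 g26's DISCHARGE KNIT `spreadFibreLawHJ_of_dischargeInputs` (Theorems-side edition of the crux workfile `Cruxes/…/DischargeKnit_LEAD_w3g26.lean` v0.3, ★★OWNER RULING
№77 (3)) reduces `SpreadFibreLawHJ` BY NAME to the row of PRINT-SHAPED discharge inputs `OrganDischargeInputsHJ` (DEFS file `FluctuationComparisonRegPrIntLRunpairOrganDischargeInputsHJDefs`, the FROZEN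
edition «b» of `Cruxes/…/DischargeInputsHJ.lean` v0.3: prefix + chart [0]–[11] of `SpreadFibreLawHJ` VERBATIM, then (I-geo) displacement letters `c Dw Db DP` with RULING №78 (T1)(T2),
(I-curv) curvature∕speed letters `kP gP KP KP2` + tail schedule, (I-law) Lipschitz score data + covariance kernels, (I-cov) covariance kernel + profiles).  So:

  ★★★`oneStepTransportUH_of_dischargeInputsHJ (h : OrganDischargeInputsHJ) : ⟨O1ᵘ-H v2.2, VERBATIM = ✓p814811's ∕ ✓p812444's conclusion, ws16 6a04f4fc⟩ :=`
  `  oneStepTransportUH_of_spreadFibreLawHJ (spreadFibreLawHJ_of_dischargeInputs h)`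

After this file the organ stub's debt is, BY KERNEL AND BY NAME, exactly {`OrganDischargeInputsHJ`} (plus the line file's other stubs) — a RELOCATION of the debt one rung
closer to print ([Balaban1985Variational] Thm 1 ∕ Prop 9 chart letters; the curvature clause; [Balaban1987RG1] Thm 3 ∕ (0.30)-type kernels), NOT a discharge: the row is
EXACTLY AS OPEN as `SpreadFibreLawHJ` was (RULING №77 (5)).  On (I-geo)'s wide `hglob` see HOME `ym-ust-20520-w4/g24/TN-HGLOB-FRAME-w4g24.md` (what its discharge asks of the
chart's frame).

HONEST FRAMING: a two-name term; nothing of Bałaban's analysis is asserted or proved; `OrganDischargeInputsHJ`, `SpreadFibreLawHJ`, `SpreadFibreLawH`, LIN″, JEN″, JVAR″,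
O1ᵘ-H v2.2 (now a theorem MODULO `OrganDischargeInputsHJ` only), S1aᴴ, S3ᴴ, 26243, S2α′, S2β and the five registered stubs are OPEN ∕ hypotheses; crux 20520
`FluctuationComparisonRegPrIntL` ∕ `YM3TorusSU2` are NOT proved; no summit ∕ sub-problem statement is proved; rung R3 = SU(2) YM₃ on T³ at fixed lattice data — NOT d = 4,
NOT infinite volume, NOT a mass gap, NOT Clay; the Yang–Mills mass gap is NOT proved.  [folklore] composition.  Credit: LEAD w3 g26 (DISCHARGE-SPEC, knit), ideator g28∕g29
(rows), px19 g20 ((I-geo)∕(I-curv), JT-E2E), w5 g24 ((I-law), (L23)–(L30)), px5 g20 ((I-cov), COV-SANDWICH), w4 g23 (✓p814811), desk g44.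
-/

set_option autoImplicit false

noncomputable section

namespace Summit.QuantumFields.YangMills.Theorems.OrganTangentOneStepTransportUHOfDischargeInputsHJ

open MeasureTheory Filter Topology Function
open scoped ENNReal
open Literature.MathematicalPhysics.QuantumFieldTheory.Balaban1983to89 T3ContinuumYM3Torus T3NestedUnitLaws
  T3UnitLawDensityEML T4Continuum BalabanUVClass T3UnitScaleTilt T3LevelShift T3TiltDescent
open T4CubeChartExp (expPt)
open Summit.QuantumFields.YangMills.Theorems.FluctuationComparisonRegPrIntLRunpairOrganDischargeInputsHJ (OrganDischargeInputsHJ)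
open Summit.QuantumFields.YangMills.Theorems.OrganTangentOneStepTransportUHOfSpreadFibreLawHJ (oneStepTransportUH_of_spreadFibreLawHJ)

/-- ★★★ **THE CONE'S APEX v2**: O1ᵘ-H v2.2 (= `Lines/runpair_organ.lean` v18.4 `OneStepTransportUH`, text VERBATIM from ✓p814811's conclusion) from the ONE frozen row of
print-shaped discharge inputs `OrganDischargeInputsHJ`, by composing ✓p814811 with the discharge knit.  A relocation of the stub's debt one rung closer to print; nothing of
Bałaban's is proved.
[cite: Balaban1985Variational, Thm 1 p.279 and Prop 9 p.309; Balaban1987RG1, Thm 1 (0.22)-(0.30) pp.256-258 and Thm 3 p.264; Balaban1985UV3, (41)-(47) pp.266-267; Balaban1985Averaging, (10)-(13) p.19] -/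
theorem oneStepTransportUH_of_dischargeInputsHJ (h : OrganDischargeInputsHJ) :
    ∃ pW : ℝ, ∃ γ₁ : ℝ, 0 < γ₁ ∧ ∀ (F : T3Family) (γ : ℝ), 0 < γ → γ ≤ γ₁ → ∀ (b₀ p₀ : ℝ) (j₀ : ℕ) (prm : ℕ → ClassParams) (η : ℕ → ℝ) (rA : ℝ) (Bρ : ℕ → ℝ), 0 < b₀ → 0 < p₀ → pW ≤ p₀ → AdmissibleClassParams F γ b₀ p₀ prm → (∀ j, 0 ≤ η j) → Summable η → Summable (fun i => ∑' k, η (k + i)) → Tendsto (fun j => (∑' k, η (k + j)) * ((1 + 2 * ((F.L : ℝ) ^ j / γ) * (Fintype.card (Plaq (F.P j) 0) : ℝ)) * (Fintype.card (PBond (F.P j) 0) : ℝ) ^ 2)) atTop (𝓝 0) → 0 < rA → ∃ κ₀ : ℝ, 0 < κ₀ ∧ ∀ (κ : ℝ), 0 < κ → κ ≤ κ₀ → ∃ (θ r Ctr C w₀ : ℝ) (εd δ : ℕ → ℝ) (j₁ : ℕ), 0 < θ ∧ 0 < r ∧ 1 ≤ Ctr ∧ 0 ≤ C ∧ 0 <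 w₀ ∧ (∀ j, 0 ≤ εd j ∧ 0 ≤ δ j) ∧ Summable εd ∧ Summable δ ∧ Summable (fun i => ∑' k, δ (k + i)) ∧ Tendsto (fun j => (∑' k, δ (k + j)) * ((1 + 2 * ((F.L : ℝ) ^ j / γ) * (Fintype.card (Plaq (F.P j) 0) : ℝ)) * (Fintype.card (PBond (F.P j) 0) : ℝ) ^ 2)) atTop (𝓝 0) ∧ j₀ ≤ j₁ ∧ ∀ (ν : ℕ → (j : ℕ) → MeasureTheory.Measure (GaugeField (F.P j) 0 ↥(Matrix.specialUnitaryGroup (Fin 2) ℂ))), (∀ K, ν K K = T4GenFunBounds.gibbsMeasure (F.P K) ((F.scheme ℰp γ).β K)) → (∀ K j, j < K → ν K j = Measure.map (descend F ℰp j) (ν K (j + 1))) → ∀ (K K' : ℕ), K ≤ K' → ∀ (Ts T : ℕ), Ts < T → T ≤ K → ∀ (μ μ' : ((j : ℕ) → MeasureTheory.Measure (GaugeField (F.P j) 0 ↥(Matrix.specialUnitaryGroup (Fin 2) ℂ)))) (ρ ρ' : ((j : ℕ) → GaugeField (F.P j) 0 ↥(Matrix.specialUnitaryGroup (Fin 2)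 ℂ) → ℝ)), (∀ j : ℕ, Ts ≤ j → j ≤ T → μ j = ν K j ∧ μ' j = ν K' j) → (∀ j : ℕ, j < Ts → μ j = Measure.map (descend F ℰp j) ((μ (j + 1)).withDensity (fun U => ENNReal.ofReal ((∏ p : Plaq _ _, max 0 (min 1 ((24 / 25 * (θBal F.L γ b₀ p₀ (j + 1)) - dist1 (GaugeField.plaqHol U p)) / ((24 / 25 - 1 / 2) * (θBal F.L γ b₀ p₀ (j + 1))))))))) ∧ μ' j = Measure.map (descend F ℰp j) ((μ' (j + 1)).withDensity (fun U => ENNReal.ofReal ((∏ p : Plaq _ _, max 0 (min 1 ((24 / 25 * (θBal F.L γ b₀ p₀ (j + 1)) - dist1 (GaugeField.plaqHol U p)) / ((24 / 25 - 1 / 2) * (θBal F.L γ b₀ p₀ (j + 1)))))))))) → (∀ j : ℕ, Ts ≤ j → j < T → μ j = Measure.map (descend F ℰp j) (μ (j + 1)) ∧ μ' j = Measure.map (descend F ℰp j) (μ' (j + 1))) → (∀ j : ℕ, j ≤ T → IsFiniteMeasure (μ j) ∧ IsFiniteMeasure (μ' j)) → (∀ j : ℕ, j₀ ≤ j → j ≤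 T → ((∀ U, PlaqSmall (θBal F.L γ b₀ p₀ j) U → 0 < ρ j U ∧ 0 < ρ' j U) ∧ μ j = (fieldMeasure _ _ _).withDensity (fun U => ENNReal.ofReal (ρ j U)) ∧ μ' j = (fieldMeasure _ _ _).withDensity (fun U => ENNReal.ofReal (ρ' j U)) ∧ (∃ κ : ℝ, MemAtHeight F ℰp j (prm j) (fun U => Real.exp κ * ρ j U)) ∧ (∃ κ : ℝ, MemAtHeight F ℰp j (prm j) (fun U => Real.exp κ * ρ' j U)) ∧ μ j {U | ¬ PlaqSmall (θBal F.L γ b₀ p₀ j) U} ≤ ENNReal.ofReal (η j) ∧ μ' j {U | ¬ PlaqSmall (θBal F.L γ b₀ p₀ j) U} ≤ ENNReal.ofReal (η j) ∧ (ContinuousOn (ρ j) {U | PlaqSmall (θBal F.L γ b₀ p₀ j) U} ∧ ContinuousOn (ρ' j) {U | PlaqSmall (θBal F.L γ b₀ p₀ j) U}) ∧ ((∀ (U : GaugeField _ _ ↥(Matrix.specialUnitaryGroup (Fin 2) ℂ)), PlaqSmall (49 / 50 * θBal F.L γ b₀ p₀ j) U → ∀ (b b' : PBond _ _) (v v' :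 Fin 3 → ℝ), ‖v‖ ≤ 1 → ‖v'‖ ≤ 1 → ∃ g : ℂ × ℂ → ℂ, DifferentiableOn ℂ g (Metric.ball (0 : ℂ) (rA * (49 / 50 * θBal F.L γ b₀ p₀ j)) ×ˢ Metric.ball (0 : ℂ) (rA * (49 / 50 * θBal F.L γ b₀ p₀ j))) ∧ (∀ (s t : ℝ) (V Z : GaugeField _ _ ↥(Matrix.specialUnitaryGroup (Fin 2) ℂ)), |s| < rA * (49 / 50 * θBal F.L γ b₀ p₀ j) → |t| < rA * (49 / 50 * θBal F.L γ b₀ p₀ j) → (∀ e, e ≠ b → V e = U e) → V b = U b * expPt (s • v) → (∀ e, e ≠ b' → Z e = V e) → Z b' = V b' * expPt (t • v') → g ((s : ℂ), (t : ℂ)) = (((Real.log (ρ j Z)) : ℝ) : ℂ)) ∧ ∀ z ∈ Metric.ball (0 : ℂ) (rA * (49 / 50 * θBal F.L γ b₀ p₀ j)) ×ˢ Metric.ball (0 : ℂ) (rA * (49 / 50 * θBal F.L γ b₀ p₀ j)), ‖g z - g 0‖ ≤ (Bρ j)) ∧ (∀ (U : GaugeField _ _ ↥(Matrix.specialUnitaryGroup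 (Fin 2) ℂ)), PlaqSmall (49 / 50 * θBal F.L γ b₀ p₀ j) U → ∀ (b b' : PBond _ _) (v v' : Fin 3 → ℝ), ‖v‖ ≤ 1 → ‖v'‖ ≤ 1 → ∃ g : ℂ × ℂ → ℂ, DifferentiableOn ℂ g (Metric.ball (0 : ℂ) (rA * (49 / 50 * θBal F.L γ b₀ p₀ j)) ×ˢ Metric.ball (0 : ℂ) (rA * (49 / 50 * θBal F.L γ b₀ p₀ j))) ∧ (∀ (s t : ℝ) (V Z : GaugeField _ _ ↥(Matrix.specialUnitaryGroup (Fin 2) ℂ)), |s| < rA * (49 / 50 * θBal F.L γ b₀ p₀ j) → |t| < rA * (49 / 50 * θBal F.L γ b₀ p₀ j) → (∀ e, e ≠ b → V e = U e) → V b = U b * expPt (s • v) → (∀ e, e ≠ b' → Z e = V e) → Z b' = V b' * expPt (t • v') → g ((s : ℂ), (t : ℂ)) = (((Real.log (ρ' j Z)) : ℝ) : ℂ)) ∧ ∀ z ∈ Metric.ball (0 : ℂ) (rA * (49 / 50 * θBal F.L γ b₀ p₀ j)) ×ˢ Metric.ball (0 : ℂ) (rA * (49 / 50 * θBal F.L γ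 b₀ p₀ j)), ‖g z - g 0‖ ≤ (Bρ j))))) → ∀ (w : ℝ), 0 ≤ w → w / (((F.L : ℝ) ^ Ts / γ) * θBal F.L γ b₀ p₀ Ts ^ 2) ≤ w₀ → (∃ k : PBond (F.P Ts) 0 → PBond (F.P Ts) 0 → ℝ, (∀ b b', 0 ≤ k b b') ∧ (∀ b, ∑ b', k b b' * Real.exp (κ * (b.src.tdist b'.src : ℝ)) ≤ w) ∧ (∀ (b b' : PBond _ _) (v v' : Fin 3 → ℝ) (U V W Z : GaugeField _ _ ↥(Matrix.specialUnitaryGroup (Fin 2) ℂ)), ‖v‖ ≤ (rA / 2) * (θBal F.L γ b₀ p₀ Ts / 4) → ‖v'‖ ≤ (rA / 2) * (θBal F.L γ b₀ p₀ Ts / 4) → PlaqSmall (θBal F.L γ b₀ p₀ Ts / 4) U → PlaqSmall (θBal F.L γ b₀ p₀ Ts / 4) V → PlaqSmall (θBal F.L γ b₀ p₀ Ts / 4) W → PlaqSmall (θBal F.L γ b₀ p₀ Ts / 4) Z → (∀ e, e ≠ b → V e = U e) → V b = U b * expPt v → (∀ e, e ≠ b' → W e = U e) → W b' = U b' * expPt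 v' → (∀ e, e ≠ b' → Z e = V e) → Z b' = V b' * expPt v' → |(Real.log (ρ Ts Z) - Real.log (ρ' Ts Z)) - (Real.log (ρ Ts V) - Real.log (ρ' Ts V)) - (Real.log (ρ Ts W) - Real.log (ρ' Ts W)) + (Real.log (ρ Ts U) - Real.log (ρ' Ts U))| ≤ k b b' * (‖v‖ / (θBal F.L γ b₀ p₀ Ts / 4)) * (‖v'‖ / (θBal F.L γ b₀ p₀ Ts / 4)))) → ∀ (j : ℕ), j₁ ≤ j → j + 1 ≤ Ts → ∃ (c' : Plaq (F.P j) 0 → ℝ) (a' w' : ℝ), 0 ≤ a' ∧ 0 ≤ w' ∧ a' + θ * (w' / (((F.L : ℝ) ^ j / γ) * θBal F.L γ b₀ p₀ j ^ 2)) ≤ (Ctr + εd (T - (Ts + 1)) + C * (w / (((F.L : ℝ) ^ Ts / γ) * θBal F.L γ b₀ p₀ Ts ^ 2))) * (w / (((F.L : ℝ) ^ Ts / γ) * θBal F.L γ b₀ p₀ Ts ^ 2)) + δ j ∧ (∀ p, |c' p| ≤ a') ∧ ∃ k' : PBond (F.P j) 0 → PBond (F.P j) 0 → ℝ, (∀ b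 b', 0 ≤ k' b b') ∧ (∀ b, ∑ b', k' b b' * Real.exp (κ * (b.src.tdist b'.src : ℝ)) ≤ w') ∧ (∀ (b b' : PBond _ _) (v v' : Fin 3 → ℝ) (U V W Z : GaugeField _ _ ↥(Matrix.specialUnitaryGroup (Fin 2) ℂ)), ‖v‖ ≤ r * (θBal F.L γ b₀ p₀ j / 4) → ‖v'‖ ≤ r * (θBal F.L γ b₀ p₀ j / 4) → PlaqSmall (θBal F.L γ b₀ p₀ j / 4) U → PlaqSmall (θBal F.L γ b₀ p₀ j / 4) V → PlaqSmall (θBal F.L γ b₀ p₀ j / 4) W → PlaqSmall (θBal F.L γ b₀ p₀ j / 4) Z → (∀ e, e ≠ b → V e = U e) → V b = U b * expPt v → (∀ e, e ≠ b' → W e = U e) → W b' = U b' * expPt v' → (∀ e, e ≠ b' → Z e = V e) → Z b' = V b' * expPt v' → |(Real.log (ρ j Z) - Real.log (ρ' j Z) - ((F.L : ℝ) ^ j / γ) * ∑ p, c' p * (1 - reTr (GaugeField.plaqHol Z p))) - (Real.log (ρ j V) - Real.log (ρ' j V) - ((F.L : ℝ) ^ j / γ) * ∑ p, c' p * (1 -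 reTr (GaugeField.plaqHol V p))) - (Real.log (ρ j W) - Real.log (ρ' j W) - ((F.L : ℝ) ^ j / γ) * ∑ p, c' p * (1 - reTr (GaugeField.plaqHol W p))) + (Real.log (ρ j U) - Real.log (ρ' j U) - ((F.L : ℝ) ^ j / γ) * ∑ p, c' p * (1 - reTr (GaugeField.plaqHol U p)))| ≤ k' b b' * (‖v‖ / (θBal F.L γ b₀ p₀ j / 4)) * (‖v'‖ / (θBal F.L γ b₀ p₀ j / 4))) :=
  oneStepTransportUH_of_spreadFibreLawHJ (Summit.QuantumFields.YangMills.Theorems.OrganTangentSpreadFibreLawHJOfDischargeInputs.spreadFibreLawHJ_of_dischargeInputs h)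

end Summit.QuantumFields.YangMills.Theorems.OrganTangentOneStepTransportUHOfDischargeInputsHJ

end
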